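import Literature.NumberTheory.EllipticCurves.FineSelmerStatementATotallyComplexProofs
import Literature.NumberTheory.EllipticCurves.FineSelmerBaseChangeModelProofs
import Literature.NumberTheory.EllipticCurves.SelmerTorsionRestriction
import Literature.NumberTheory.IwasawaTheory.ClassicalMuVanishesUnramifiedClassesProofs
import Literature.NumberTheory.GaloisRepresentations.AbsGaloisRestrictSurjective
import HarnessLib

/-!
# Statement (A) of Coates–Sujatha UPSTAIRS, in the subgroup model: `Sel₀(L_∞, E[p^∞])[p]` finite over
# `res(Gal(L̄/L_∞)) ≤ Γ_K` for a totally complex `L ⊇ K(E[p])` with Iwasawa's classical `μ = 0` (proved; no named fact)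

`Proofs`-style file (theorems only: no definition, no named fact, no `sorry`) in topic `NumberTheory/EllipticCurves`
(namespace `Literature.NumberTheory.EllipticCurves.FineSelmerUpstairs`), written by the prover seat
`cruxlead-stmt-BirchSwinnertonDyer-19573-w2` GEN 6 (cell `bsd-2adic`; `--supports` stmt-BirchSwinnertonDyer-19573, crux 202
`OrdKatoHalfAtTwoIso` of K4 `ByReductionTypeAtTwo`). It is the generic layer of the discharge of the named fact
`Lim2017.thm35_at_two_upstairs_fineSelmer_twoTorsion_finite_of_classicalMuVanishes` (sequel file
`FineSelmerLimThm35AtTwoUpstairsProofs.lean`). Closes nothing; Conjecture A is proved for no curve unconditionally; BSD is not proved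
by any of this.

## What is proved (Lim 2017, proof of Thm. 3.1/3.5 for the carrier `F(μ_{2p}, T/𝔪T)` itself: no real place, no `p`-extension step)

* §1 (any number field `K`, any normal `H ≤ Γ_K`, any discrete `M`, any `p`): `mem_strictSelmerGroupOver_fineData_iff` — membership
  in Greenberg's strict Selmer group for the FINE data over `K̄^H` as the vanishing of restrictions at the chosen decomposition groups
  (the tree's `FineSelmerCoefficientMap.mem_fineSelmerInfty_iff_resOfLe` is `H = ker κ`); and
  `resOfLe_decompositionSubgroup_eq_zero_of_mem_strictSelmerGroupOver_fineData` — such a class restricts to zero on `H ⊓ D_𝔓` for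
  EVERY maximal ideal `𝔓 ⊂ \bar ℤ_K` (generic-`H` form of `FineSelmerDevissage.exists_eq_smul_sub_of_mem_fineSelmerInfty`:
  `D_𝔓 = g D_v g⁻¹`, `exists_conj_mem_decomp_of_mem_decompositionSubgroup`, and the fine condition for `conj_{g⁻¹} c`).
* §2 (any number field `K`, any prime `p`, `E = W/K` elliptic, `L/K` finite TOTALLY COMPLEX with `Γ_L` fixing `E[p]` through
  `res : Γ_L → Γ_K`, `κ_L` a CYCLOTOMIC `ℤ_p`-extension of `L` with `ClassicalMuVanishes κ_L`):
  **`finite_strictFine_pTorsion_galImage_of_classicalMuVanishes`** — for every normal `Ω ≤ Γ_K` EQUAL to the subgroup model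
  `galImage(ker κ_L) = res(Gal(L̄/L_∞))`, the classes of the strict fine Selmer group of `E[p^∞]` over `K̄^Ω = L_∞` killed by `p` form a
  FINITE set. DOWNSTAIRS OVER THE BASE `L` for `E_L`: Iwasawa's `μ = 0` in character form — the DISCHARGED tree fact
  `ClassicalMuVanishesUnramifiedClasses.classicalMuVanishes_finite_unramifiedClasses_holds` (bsd-potss-rkm g34), totally complex
  branch — ⇒ `Sel₀(L_∞, E_L[p])` finite
  (`FineSelmerFiniteOfUnramifiedClasses.finite_fineSelmerInfty_of_classicalMuVanishes_of_odd_or_isTotallyComplex` with `F = K = L`: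
  the trivialising field of `E_L[p]` is `L`, `range_absGaloisRestrict_eq_top`) ⇒ `Sel₀(L_∞, E_L[p^∞])[p]` finite
  (`FineSelmerCoefficientMap.finite_fineSelmerInfty_pTorsion_of_finite_torsion_of_forall_infinitePlace`; the archimedean local kernels
  vanish at COMPLEX places, `FineBaseChangeModel.subgroupH1_inf_decompInf_eq_zero_of_isComplex`); then TRANSPORT along the base-change
  model `BaseChangeModel.subgroupModelIso : H¹(ker κ_L, E_L[p^∞]) ≃+ H¹(galImage(ker κ_L), E[p^∞])` (cell bsd-2adic seat t42), whose
  fine classes are characterised prime-wise (`FineBaseChangeModel.mem_fineSelmerInfty_of_forall_prime_subgroupModelIso`, seat conv-1),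
  §1 supplying the prime-wise vanishing of every strict fine class of the model. `smul_geomTorsion_baseChange_eq_self_of_resGal`:
  `Γ_L` fixes `E_L[n]` when `res(Γ_L)` fixes `E[n]` (`torsionBaseChangeMap_smul`).

References: [Lim2017FineSelmer] M. F. Lim, *Notes on the fine Selmer groups*, Asian J. Math. 21 (2017) = arXiv:1306.2047, §3
Thm. 3.5, Lemma 3.2, proof of Thm. 3.1 («so that `F` contains `μ_{2p}` (in particular, `F` has no real primes)»);
[CoatesSujatha2005] J. Coates, R. Sujatha, Math. Ann. 331 (2005), §3 Thm. 3.4 (proof), Lemma 3.3; [LimSujatha2018] §3 (proof of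
Prop. 3.2); [GreenbergLNM1716] §1 p. 60, §2, §3; [Greenberg1989] §1 p. 98; [Lang1990] Ch. 5 §§1–4; [SerreGaloisCohomology1997]
I.§2.4–2.5, II.§1.1.
-/

set_option autoImplicit false

noncomputable section

open scoped Classical Pointwise

namespace Literature.NumberTheory.EllipticCurves.FineSelmerUpstairs

open NumberField IsDedekindDomain Field _root_.WeierstrassCurve
open Literature.NumberTheory.EllipticCurves Literature.NumberTheory.EllipticCurves.GreenbergSelmer
  Literature.NumberTheory.EllipticCurves.FineSelmerTrivialisingRestriction
  Literature.NumberTheory.GaloisRepresentations Literature.NumberTheory.IwasawaTheory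

/-! ## §1 A strict fine class over `K̄^H` is a coboundary on `H ⊓ D_𝔓` for EVERY maximal `𝔓 ⊂ \bar ℤ_K` -/

section Primewise

variable {K : Type} [Field K] [NumberField K]
variable {M : Type} [AddCommGroup M] [DistribMulAction (absoluteGaloisGroup K) M] [TopologicalSpace M]
  [DiscreteTopology M]

/-- **Membership in Greenberg's strict Selmer group for the fine data, as the vanishing of restrictions at the chosen
decomposition groups** (generic normal `H ≤ Γ_K`; the tree's `FineSelmerCoefficientMap.mem_fineSelmerInfty_iff_resOfLe` is the
case `H = ker κ`, and the Summits-side `…AlignedTransportAtTwoFineRoad.StrictPerfectDescent.mem_strictSelmerGroupOver_fine_iff_resOfLe`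
(cell bsd-f1-sign2) is the same statement — re-homed here because a Literature file cannot import a Theorems file): `c` is strict-fine iff `conj_σ c` restricts to zero on `H ⊓ D_v` for every finite `v` and every `σ`, and on
`H ⊓ D_w` for every infinite `w` and every `σ`. [cite: Greenberg1989, §1 p. 98] [cite: CoatesSujatha2005, §3 (definition of R(E/F_∞))] -/
theorem mem_strictSelmerGroupOver_fineData_iff (H : Subgroup (absoluteGaloisGroup K)) [H.Normal] (p : ℕ)
    (c : subgroupH1 H M) :
    c ∈ strictSelmerGroupOver H M p (fineData M p) ↔
      (∀ (v : HeightOneSpectrum (𝓞 K)) (σ : absoluteGaloisGroup K),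
          resOfLe M (inf_le_left : H ⊓ decomp v ≤ H) (conjH1 H M σ c) = 0) ∧
        ∀ (w : InfinitePlace K) (σ : absoluteGaloisGroup K),
          resOfLe M (inf_le_left : H ⊓ decompInf w ≤ H) (conjH1 H M σ c) = 0 := by
  rw [mem_strictSelmerGroupOver_iff]
  constructor
  · rintro ⟨h1, h2, h3⟩
    refine ⟨fun v σ ↦ ?_, fun w σ ↦ h2 w σ⟩
    by_cases hv : ((p : ℕ) : 𝓞 K) ∈ v.asIdeal
    · exact (FineSelmerCoefficientMap.mem_strictKer_fineLocalDatum_iff _ v _).1 (h3 v hv σ)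
    · exact h1 v hv σ
  · rintro ⟨h1, h2⟩
    exact ⟨fun v _ σ ↦ h1 v σ, fun w σ ↦ h2 w σ,
      fun v _ σ ↦ (FineSelmerCoefficientMap.mem_strictKer_fineLocalDatum_iff _ v _).2 (h1 v σ)⟩

/-- **A strict fine class over `K̄^H` restricts to zero on `H ⊓ D_𝔓` for EVERY maximal ideal `𝔓` of `\bar ℤ_K`** (generic
normal `H`; the tree's `FineSelmerDevissage.exists_eq_smul_sub_of_mem_fineSelmerInfty` is the case `H = ker κ`): the decomposition
group of `𝔓` is `g D_v g⁻¹` for the chosen `D_v` above `v = 𝔓 ∩ 𝓞_K` (`exists_conj_mem_decomp_of_mem_decompositionSubgroup`), the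
fine condition for `conj_{g⁻¹} [z]` at `v` gives `g⁻¹ • z(g y g⁻¹) = y • a − a` on `H ⊓ D_v`, whence `z(x) = x • (g • a) − g • a` on
`H ⊓ D_𝔓`. [cite: CoatesSujatha2005, §3 (Lemma 3.3: locally trivial at every place)] [cite: SerreGaloisCohomology1997, I.§2.5] -/
theorem resOfLe_decompositionSubgroup_eq_zero_of_mem_strictSelmerGroupOver_fineData
    (H : Subgroup (absoluteGaloisGroup K)) [H.Normal] {p : ℕ} {c : subgroupH1 H M}
    (hc : c ∈ strictSelmerGroupOver H M p (fineData M p))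
    (𝔓 : Ideal (absIntegers (𝓞 K) K)) [𝔓.IsMaximal] :
    resOfLe M (inf_le_left : H ⊓ 𝔓.decompositionSubgroup (absoluteGaloisGroup K) ≤ H) c = 0 := by
  have hloc := ((mem_strictSelmerGroupOver_fineData_iff H p c).1 hc).1
  obtain ⟨v, g, hg⟩ := exists_conj_mem_decomp_of_mem_decompositionSubgroup 𝔓
  obtain ⟨z, rfl⟩ := oneCocycleClass_surjective _ c
  obtain ⟨a, ha⟩ := (CocycleCriteria.conjH1_oneCocycleClass_mem_ker_resOfLe_iff
    (inf_le_left : H ⊓ decomp v ≤ H) g⁻¹ z).1 (hloc v g⁻¹)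
  refine (CocycleCriteria.resOfLe_oneCocycleClass_eq_zero_iff _ z).2 ⟨g • a, fun x ↦ ?_⟩
  obtain ⟨hxH, hxD⟩ := Subgroup.mem_inf.1 x.2
  have hyD : g⁻¹ * (x : absoluteGaloisGroup K) * g ∈ decomp v := hg _ hxD
  have hyH : g⁻¹ * (x : absoluteGaloisGroup K) * g ∈ H := by
    simpa only [inv_inv] using (inferInstance : H.Normal).conj_mem _ hxH g⁻¹
  have h := ha ⟨g⁻¹ * (x : absoluteGaloisGroup K) * g, Subgroup.mem_inf.2 ⟨hyH, hyD⟩⟩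
  have hconj : subgroupConj H g⁻¹
      (Subgroup.inclusion (inf_le_left : H ⊓ decomp v ≤ H)
        ⟨g⁻¹ * (x : absoluteGaloisGroup K) * g, Subgroup.mem_inf.2 ⟨hyH, hyD⟩⟩) =
        Subgroup.inclusion
          (inf_le_left : H ⊓ 𝔓.decompositionSubgroup (absoluteGaloisGroup K) ≤ H) x := by
    apply Subtype.ext
    simp only [subgroupConj_apply_coe, Subgroup.coe_inclusion, inv_inv]
    group
  rw [hconj] at h
  have h2 : z.1 (Subgroup.inclusion
      (inf_le_left : H ⊓ 𝔓.decompositionSubgroup (absoluteGaloisGroup K) ≤ H) x) =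
        g • ((g⁻¹ * (x : absoluteGaloisGroup K) * g) • a - a) := by
    rw [← h, smul_inv_smul]
  rw [h2, smul_sub, smul_smul, ← mul_assoc, ← mul_assoc, mul_inv_cancel, one_mul, mul_smul]

end Primewise

/-! ## §2 Statement (A) upstairs in the subgroup model: `Sel₀(L_∞, E[p^∞])[p]` finite over `galImage(ker κ_L) ≤ Γ_K` -/

section Upstairs

variable {K : Type} [Field K] [NumberField K] (W : WeierstrassCurve K) [W.IsElliptic] {p : ℕ} [Fact p.Prime]
  {L : Type} [Field L] [NumberField L] [Algebra K L] [Algebra.IsAlgebraic K L]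

omit [NumberField K] [W.IsElliptic] [NumberField L] in
/-- **`Γ_L` fixes `E_L[n]` when it fixes `E[n]` through the restriction `res : Γ_L → Γ_K`** (the coefficient isomorphism
`E[n](K̄) ≃ E_L[n](L̄)` is `res`-equivariant, `torsionBaseChangeMap_smul`). [cite: SerreGaloisCohomology1997, I.§2.4 and II.§1.1] -/
theorem smul_geomTorsion_baseChange_eq_self_of_resGal (n : ℤ)
    (htriv : ∀ (σ : absoluteGaloisGroup L) (P : geomTorsion W n), resGal (K := K) L σ • P = P)
    (σ : absoluteGaloisGroup L) (T : geomTorsion (W.baseChange L) n) : σ • T = T := by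
  obtain ⟨P, rfl⟩ := (torsionBaseChangeEquiv L W n).surjective T
  rw [torsionBaseChangeEquiv_apply, ← torsionBaseChangeMap_smul, htriv σ P]

/-- **Statement (A) UPSTAIRS in the subgroup model.** `K` a number field, `E = W/K` elliptic, `p` a prime, `L ⊇ K` a finite TOTALLY
COMPLEX extension whose absolute Galois group fixes `E[p]` (through `res : Γ_L → Γ_K`), `κ_L` a CYCLOTOMIC `ℤ_p`-extension of `L`
with Iwasawa's classical `μ = 0` (growth form). Then, in the subgroup model `H¹(galImage(ker κ_L), E[p^∞])` of
`H¹(L_∞, E_L[p^∞])` (`galImage(ker κ_L) = res(Gal(L̄/L_∞)) ≤ Γ_K`, assumed normal in `Γ_K`), the classes of Greenberg's strict Selmer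
group for the fine data that are killed by `p` form a FINITE set. Downstairs over the base `L`: Iwasawa's `μ = 0` in character form
(DISCHARGED tree fact `classicalMuVanishes_finite_unramifiedClasses_holds`, totally complex branch) ⇒ `Sel₀(L_∞, E_L[p])` finite ⇒
`Sel₀(L_∞, E_L[p^∞])[p]` finite (complex places impose nothing); then the base-change model `subgroupModelIso` and its prime-wise
description of the fine classes, fed by §1. [cite: Lim2017FineSelmer, §3 Thm. 3.5 and proof of Thm. 3.1 (arXiv:1306.2047 pp. 6–7)]
[cite: CoatesSujatha2005, §3 Thm. 3.4 (proof) and Lemma 3.3] [cite: LimSujatha2018, §3 (proof of Prop. 3.2)] -/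
theorem finite_strictFine_pTorsion_galImage_of_classicalMuVanishes
    (hL : ∀ w : InfinitePlace L, w.IsComplex)
    (htriv : ∀ (σ : absoluteGaloisGroup L) (P : geomTorsion W (p : ℤ)), resGal (K := K) L σ • P = P)
    (κL : ZpExtension L p) (hκL : κL.IsCyclotomic) (hμ : ClassicalMuVanishes κL)
    (Ω : Subgroup (absoluteGaloisGroup K)) [Ω.Normal]
    (hΩ : Ω = BaseChangeModel.galImage K L κL.kerSubgroup) :
    Set.Finite {c : W.subgroupH1 p Ω |
      c ∈ strictSelmerGroupOver Ω (geomPrimaryTorsion W p) p (fineData (geomPrimaryTorsion W p) p) ∧ p • c = 0} := by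
  subst hΩ
  haveI hne : NeZero p := ⟨(Fact.out : p.Prime).ne_zero⟩
  set WL : WeierstrassCurve L := W.baseChange L with hWL
  -- (1) `Sel₀(L_∞, E_L[p])` is finite
  have hfin : (GreenbergSelmer.fineSelmerInfty (↥(geomTorsion WL (p : ℤ))) κL :
      Set (subgroupH1 κL.kerSubgroup (geomTorsion WL (p : ℤ)))).Finite := by
    haveI : Finite (geomTorsion WL (p : ℤ)) := WL.finite_geomTorsion_nat (NeZero.ne p)
    haveI : ContinuousSMul (absoluteGaloisGroup L) (geomTorsion WL (p : ℤ)) :=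
      WL.continuousSMul_geomTorsion WL.isOpen_stabilizer_point_holds p
    have hcard : ∃ k : ℕ, Nat.card (geomTorsion WL (p : ℤ)) = p ^ k :=
      ⟨2, WL.natCard_geomTorsion_eq_sq_of_charZero (Fact.out : p.Prime)⟩
    have htrivL : ∀ (σ : absoluteGaloisGroup L) (T : geomTorsion WL (p : ℤ)), σ • T = T :=
      smul_geomTorsion_baseChange_eq_self_of_resGal W (p : ℤ) htriv
    have hrange : (absGaloisRestrict L L).range = fixingSubgroupOfModule L (geomTorsion WL (p : ℤ)) := by
      have h1 : (absGaloisRestrict L L).range = ⊤ := range_absGaloisRestrict_eq_top L L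
      have h2 : fixingSubgroupOfModule L (geomTorsion WL (p : ℤ)) = ⊤ :=
        eq_top_iff.2 fun σ _ ↦ (WL.mem_fixingSubgroupOfModule_geomTorsion_iff p).2 (htrivL σ)
      rw [h1, h2]
    exact FineSelmerFiniteOfUnramifiedClasses.finite_fineSelmerInfty_of_classicalMuVanishes_of_odd_or_isTotallyComplex
      ClassicalMuVanishesUnramifiedClasses.classicalMuVanishes_finite_unramifiedClasses_holds κL
      (↥(geomTorsion WL (p : ℤ))) hcard L (Or.inr ⟨hL⟩) hrange κL
      (FineSelmerFiniteOfUnramifiedClasses.kerSubgroup_eq_comap_of_isCyclotomic κL hκL κL hκL) hμ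
  -- (2) `Sel₀(L_∞, E_L[p^∞])[p]` is finite
  have hfin2 : Set.Finite {s : WL.fineSelmerInfty κL | p • s = 0} :=
    FineSelmerCoefficientMap.finite_fineSelmerInfty_pTorsion_of_finite_torsion_of_forall_infinitePlace WL κL hκL
      (fun w y ↦ FineBaseChangeModel.subgroupH1_inf_decompInf_eq_zero_of_isComplex _ w (hL w) y) hfin
  -- (3) transport along the base-change model
  refine (hfin2.image fun s : ↥(WL.fineSelmerInfty κL) ↦
    BaseChangeModel.subgroupModelIso K L κL.kerSubgroup W p (s : WL.subgroupH1 p κL.kerSubgroup)).subset ?_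
  rintro c ⟨hc, hpc⟩
  set x := (BaseChangeModel.subgroupModelIso K L κL.kerSubgroup W p).symm c with hx
  have hΘx : BaseChangeModel.subgroupModelIso K L κL.kerSubgroup W p x = c := by
    rw [hx, AddEquiv.apply_symm_apply]
  have hxmem : x ∈ WL.fineSelmerInfty κL :=
    FineBaseChangeModel.mem_fineSelmerInfty_of_forall_prime_subgroupModelIso W κL hL x
      (fun 𝔓 h𝔓 ↦ by
        haveI := h𝔓
        rw [hΘx]
        exact resOfLe_decompositionSubgroup_eq_zero_of_mem_strictSelmerGroupOver_fineData _ hc 𝔓)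
  refine ⟨⟨x, hxmem⟩, ?_, hΘx⟩
  show p • (⟨x, hxmem⟩ : WL.fineSelmerInfty κL) = 0
  apply Subtype.ext
  simp only [AddSubgroupClass.coe_nsmul, ZeroMemClass.coe_zero]
  rw [hx, ← map_nsmul, hpc, map_zero]

end Upstairs

end Literature.NumberTheory.EllipticCurves.FineSelmerUpstairs

end
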